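import Mathlib
import HarnessLib
import Summits.Ventures.LatticeQCDFlow.Exactness.SphereGeodesicKick
import Summits.Ventures.LatticeQCDFlow.Exactness.SphereTangentialLaplacian

/-!
# The leading-order flow action of the lattice CP(N−1)/O(N) model is `S/(2(d−1))` (Engel–Schaefer eq. (15)); its generator is `(κ/(d−1))·p_n` (eq. (16)) and the Euler step of that flow is the rung's site map `geodesicKick` (eq. (17))

HONEST FRAMING: exact (Metropolis-corrected) sampling algorithms for lattice gauge theory;
figures of merit are autocorrelation/cost numbers at stated couplings and volumes; no
continuum-physics claim.

Venture `LatticeQCDFlow` (cell pub-lqcd), topic `Exactness`; FANOUT row 7 (`s0-cpn-null`: the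
S0-D1 rung — 2D CP⁹, Lüscher's LO trivializing map inside HMC, Engel–Schaefer 2011).  NEW WORK of
the cell over Mathlib and the tree's `Exactness/SphereTangentialLaplacian.lean` (the natural
derivative `∂̃` as the derivative of `f(y/‖y‖)`, `laplacian_inner_comp_normalize`) and
`Exactness/SphereGeodesicKick.lean` (`tangentKick`, `geodesicKick`); nothing is cited as a fact.
Printed counterpart, NAMED ONLY: Engel–Schaefer, Comput. Phys. Commun. 182 (2011) 2107, §2 eqs.
(6)–(7) (the action `S[x, φ] = −Nβ Σ_n (x_nᵀ J_n − 4)`, `J_n = Σ_μ Λᵀ_{n,μ} x_{n+μ̂}`), §2.2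
eq. (13) (the force `F_n = −∂̃_n S = 2Nβ (1 − x_n x_nᵀ) J_n =: 2Nβ p_n`), §3 eqs. (14)–(17)
(the gradient ansatz `ẋ_n = −∂̃_n S̃ = T_n`, Lüscher's leading-order equation
`−Σ_n ∂̃_n·∂̃_n S̃⁽⁰⁾ = S + C`, its solution `S̃⁽⁰⁾ = S/(2(2N−1))`, the generator `T⁽⁰⁾_n ∝ p_n` and
the Euler step `x_n(t+ε_s) = cos α_n x_n + sin α_n T_n/|T_n|`, `α_n = ε_s|T_n|`); M. Lüscher, Commun.
Math. Phys. 293 (2010) 899, §4.2 eqs. (4.4)–(4.5) (the LO equation).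

## Setting

`E` a finite-dimensional real inner product space (`d = dim E`; CP(N−1): `E = ℝ^{2N} ≅ ℂ^N`,
`d = 2N`), `Λ` a finite index set of sites, couplings `U : Λ → Λ → (E →L[ℝ] E)` with NO
self-coupling (`U n n = 0`) and ADJOINT PAIRS (`⟪U m n v, w⟫ = ⟪v, U n m w⟫`; for CP(N−1) the link
rotations `Λᵀ_{n,μ}` and their transposes on the reversed links — the `U(1)` phases are frozen
parameters here, exactly as in E–S §3: "we perform the field transformation only on the `x`").

* `localField U n x = Σ_m U n m (x m)` — the spin sum `J_n` (eq. (7));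
* `esAction κ S₀ U x = −κ Σ_n ⟪x n, J_n x⟫ + S₀` — eq. (6) with `κ = Nβ`, `S₀ = 4NβV`;
* `loFlowAction κ S₀ U = (2(d−1))⁻¹ · esAction κ S₀ U` — eq. (15);
* `eulerStep ε T x = cos(ε‖T‖) x + (sin(ε‖T‖)/‖T‖) T` — eq. (17);
* `siteGrad n G x`, `siteLaplacian n G x` — E–S's `∂̃_n G` and `∂̃ⁱ_n∂̃ⁱ_n G`: gradient and
  Laplacian of `y ↦ G(x with x_n replaced by y/‖y‖)` at `y = x_n` (eq. (12), sitewise);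
  `loGenerator` — `T_n = −∂̃_n S̃⁽⁰⁾` (eqs. (14), (16)).

## Content (configurations on the product of unit spheres, `‖x n‖ = 1`)

* `esAction_update` — THE ACTION IS AFFINE IN EACH SITE VARIABLE:
  `S(x_n ← y) = S(x_n ← 0) − 2κ ⟪J_n x, y⟫` (no self-coupling + adjoint pairs: the site enters its
  own term and, through the transposed links, its neighbours' terms — the factor `2` of eq. (13)).
* **`siteGrad_esAction`** (E–S eq. (13)): `∂̃_n S = −2κ p_n`, `p_n = tangentKick (J_n x) (x n)`,
  so the HMC force is `F_n = 2κ p_n`.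
* **`siteLaplacian_esAction`**, **`neg_sum_siteLaplacian_esAction`**:
  `∂̃_n·∂̃_n S = 2κ(d−1)⟪J_n x, x_n⟫` and `−Σ_n ∂̃_n·∂̃_n S = 2(d−1)(S − S₀)` — the action is an
  eigenfunction of the lattice Laplace–Beltrami operator up to the constant (each site variable
  enters linearly; `SphereTangentialLaplacian.laplacian_inner_comp_normalize`).
* **`neg_sum_siteLaplacian_loFlowAction`** (E–S eq. (15), Lüscher's LO equation SOLVED):
  `−Σ_n ∂̃_n·∂̃_n S̃⁽⁰⁾ = S − S₀` for `S̃⁽⁰⁾ = S/(2(d−1))`, `d ≥ 2` (CP(N−1): `S̃⁽⁰⁾ = S/(2(2N−1))`).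
* **`loGenerator_eq`** (E–S eq. (16)): `T_n = −∂̃_n S̃⁽⁰⁾ = (κ/(d−1)) p_n` (`= Nβ/(2N−1) · p_n`, the
  constant that reappears in the printed Jacobian (18) and angle map; the printed right-hand side
  of (16), `2Nβ/(2N−1) p_n`, is twice this — cf. the header of `SphereGeodesicKick.lean`);
  `loGenerator_eq_force`: `T_n = F_n/(2(d−1))`.
* **`eulerStep_loGenerator`** (E–S eq. (17)): the Euler step of `ẋ = T(x)` with step `ε` at site `n`
  IS `geodesicKick (ε κ/(d−1)) (J_n x) (x n)` — the single-site map whose Jacobian, bijectivity,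
  sweep and THMC exactness are the tree's `SphereKick*.lean` / `SphereSweep*.lean`.  THE RUNG'S
  FIELD TRANSFORMATION IS THE EULER-INTEGRATED LEADING-ORDER TRIVIALIZING FLOW OF ITS OWN ACTION.

NOT CLAIMED: higher orders `S̃⁽ᵏ⁾`, `k ≥ 1`, of Lüscher's expansion; that the flow so generated
trivializes anything beyond leading order, or any statement about its Jacobian (tree:
`KickAngleJacobian`, `SphereKickJacobian*`); the `U(1)` link update (links are parameters); the
checkerboard ordering of the sweep (tree: `CheckerboardSweep`, `SphereKickSweep`); anything
quantitative about forces or autocorrelations (the rung's numbers are not restated).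
-/

noncomputable section

namespace Summit.Ventures.LatticeQCDFlow.Exactness

open NormedSpace Filter Laplacian
open scoped RealInnerProductSpace Topology Gradient

variable {E : Type*} [NormedAddCommGroup E] [InnerProductSpace ℝ E]
variable {Λ : Type*} [Fintype Λ]

/-! ## §1 The action, the local field, and affinity in each site variable -/

section Action

/-- **The local field (spin sum) `J_n(x) = Σ_m U_{nm} x_m`** (E–S eq. (7): the link-transported
sum of the neighbours; `U n m = 0` for non-neighbours). -/
def localField (U : Λ → Λ → (E →L[ℝ] E)) (n : Λ) (x : Λ → E) : E := ∑ m, U n m (x m)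

/-- **The lattice CP(N−1)/O(N) action in real form** (E–S eq. (6)):
`S[x] = −κ Σ_n ⟪x_n, J_n(x)⟫ + S₀` (`κ = Nβ`, `S₀ = 4NβV` in the paper's normalisation). -/
def esAction (κ S₀ : ℝ) (U : Λ → Λ → (E →L[ℝ] E)) (x : Λ → E) : ℝ :=
  -κ * ∑ n, ⟪x n, localField U n x⟫ + S₀

/-- **The leading-order flow action** `S̃⁽⁰⁾ = S / (2(d−1))`, `d = dim E` (E–S eq. (15); CP(N−1):
`S/(2(2N−1))`). -/
def loFlowAction (κ S₀ : ℝ) (U : Λ → Λ → (E →L[ℝ] E)) : (Λ → E) → ℝ :=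
  fun x => (2 * ((Module.finrank ℝ E : ℝ) - 1))⁻¹ * esAction κ S₀ U x

variable (U : Λ → Λ → (E →L[ℝ] E))

/-- The local field is additive in the configuration. -/
theorem localField_add (n : Λ) (x x' : Λ → E) :
    localField U n (x + x') = localField U n x + localField U n x' := by
  simp only [localField, Pi.add_apply, map_add, Finset.sum_add_distrib]

/-- Scaling the coupling and the constant scales the action. -/
theorem esAction_smul (a κ S₀ : ℝ) (x : Λ → E) :
    esAction (a * κ) (a * S₀) U x = a * esAction κ S₀ U x := by
  unfold esAction; ring

/-- `S − S₀ = −κ Σ_n ⟪x_n, J_n⟫`. -/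
theorem esAction_sub_const (κ S₀ : ℝ) (x : Λ → E) :
    esAction κ S₀ U x - S₀ = -κ * ∑ n, ⟪x n, localField U n x⟫ := by
  unfold esAction; ring

/-- `S̃⁽⁰⁾` is the action with coupling and constant divided by `2(d−1)`. -/
theorem loFlowAction_eq (κ S₀ : ℝ) :
    loFlowAction κ S₀ U = esAction ((2 * ((Module.finrank ℝ E : ℝ) - 1))⁻¹ * κ)
      ((2 * ((Module.finrank ℝ E : ℝ) - 1))⁻¹ * S₀) U := by
  funext x; rw [loFlowAction, esAction_smul]

variable [DecidableEq Λ]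

/-- The local field of a configuration supported at one site: `J_m(δ_n v) = U_{mn} v`. -/
theorem localField_single (m n : Λ) (v : E) :
    localField U m (Pi.single n v : Λ → E) = U m n v := by
  unfold localField
  rw [Finset.sum_eq_single n]
  · rw [Pi.single_eq_same]
  · intro b _ hb; rw [Pi.single_eq_of_ne hb, map_zero]
  · intro h; exact absurd (Finset.mem_univ n) h

/-- Pairing a configuration supported at one site: `Σ_m ⟪(δ_n v) m, w m⟫ = ⟪v, w n⟫`. -/
theorem sum_inner_single (n : Λ) (v : E) (w : Λ → E) :
    ∑ m, ⟪(Pi.single n v : Λ → E) m, w m⟫ = ⟪v, w n⟫ := by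
  rw [Finset.sum_eq_single n]
  · rw [Pi.single_eq_same]
  · intro b _ hb; rw [Pi.single_eq_of_ne hb, inner_zero_left]
  · intro h; exact absurd (Finset.mem_univ n) h

omit [InnerProductSpace ℝ E] [Fintype Λ] in
/-- Replacing a site variable = zeroing it and adding a configuration supported there. -/
theorem update_eq_update_zero_add_single (x : Λ → E) (n : Λ) (y : E) :
    Function.update x n y = Function.update x n 0 + Pi.single n y := by
  funext m
  by_cases h : m = n
  · subst h; simp
  · simp [Function.update_of_ne h, Pi.single_eq_of_ne h]

variable {U}

/-- With no self-coupling, the local field AT a site does not see that site's variable. -/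
theorem localField_update_self (hU0 : ∀ n, U n n = 0) (x : Λ → E) (n : Λ) (y : E) :
    localField U n (Function.update x n y) = localField U n x := by
  have key : ∀ z : E,
      localField U n (Function.update x n z) = localField U n (Function.update x n 0) := by
    intro z
    rw [update_eq_update_zero_add_single x n z, localField_add, localField_single, hU0]
    simp
  rw [key y, ← key (x n), Function.update_eq_self]

/-- **The action is affine in each site variable.**  With no self-coupling and adjoint-pair
couplings, `S(x_n ← y) = S(x_n ← 0) − 2κ ⟪J_n(x), y⟫`: the site variable enters its own term
`⟪x_n, J_n⟫` and, through the transposed couplings, each neighbour's term — whence the `2`. -/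
theorem esAction_update (hU0 : ∀ n, U n n = 0) (hUadj : ∀ m n (v w : E), ⟪U m n v, w⟫ = ⟪v, U n m w⟫)
    (κ S₀ : ℝ) (x : Λ → E) (n : Λ) (y : E) :
    esAction κ S₀ U (Function.update x n y) =
      esAction κ S₀ U (Function.update x n 0) - 2 * κ * ⟪localField U n x, y⟫ := by
  have hJm : ∀ m, localField U m (Function.update x n 0 + Pi.single n y) =
      localField U m (Function.update x n 0) + U m n y := fun m => by
    rw [localField_add, localField_single]
  have hJn : localField U n (Function.update x n 0) = localField U n x :=
    localField_update_self hU0 x n 0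
  -- the four pieces of `Σ_m ⟪(x₀ + δ_n y) m, J_m x₀ + U_{mn} y⟫`, `x₀ = (x_n ← 0)`
  have h2 : ∑ m, ⟪Function.update x n 0 m, U m n y⟫ = ⟪localField U n x, y⟫ := by
    rw [← hJn, localField, sum_inner]
    refine Finset.sum_congr rfl fun m _ => ?_
    rw [real_inner_comm ((U m n) y), hUadj, real_inner_comm]
  have h3 : ∑ m, ⟪(Pi.single n y : Λ → E) m, localField U m (Function.update x n 0)⟫ =
      ⟪localField U n x, y⟫ := by
    rw [sum_inner_single, hJn, real_inner_comm]
  have h4 : ∑ m, ⟪(Pi.single n y : Λ → E) m, U m n y⟫ = 0 := by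
    rw [sum_inner_single, hU0]; simp
  rw [update_eq_update_zero_add_single x n y, esAction, esAction]
  simp only [hJm, Pi.add_apply, inner_add_left, inner_add_right, Finset.sum_add_distrib, h2, h3,
    h4]
  ring

/-- The affine form, as functions of the site variable:
`y ↦ S(x_n ← y) = ⟪−2κ J_n(x), y⟫ + S(x_n ← 0)`. -/
theorem esAction_update_eq_inner (hU0 : ∀ n, U n n = 0)
    (hUadj : ∀ m n (v w : E), ⟪U m n v, w⟫ = ⟪v, U n m w⟫) (κ S₀ : ℝ) (x : Λ → E) (n : Λ) :
    (fun y => esAction κ S₀ U (Function.update x n y)) =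
      fun y => ⟪(-(2 * κ)) • localField U n x, y⟫ + esAction κ S₀ U (Function.update x n 0) := by
  funext y
  rw [esAction_update hU0 hUadj, real_inner_smul_left]
  ring

end Action

/-! ## §2 The Euler step on the sphere (E–S eq. (17)) and the tangential part -/

section Euler

/-- **One Euler step on the sphere** for the flow `ẋ = T(x)` with step `ε` (E–S eq. (17)):
`x ↦ cos(ε‖T‖) x + (sin(ε‖T‖)/‖T‖) T` ("the exact solution of the equation of motion in the
absence of forces but subject to `|x| = 1`", E–S eq. (11), read with momentum `T`; `= x` when
`T = 0` by `0/0 = 0`). -/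
def eulerStep (ε : ℝ) (T x : E) : E :=
  Real.cos (ε * ‖T‖) • x + (Real.sin (ε * ‖T‖) / ‖T‖) • T

/-- The tangential part is linear in the field: `tangentKick (a • J) x = a • tangentKick J x`. -/
theorem tangentKick_smul (a : ℝ) (J x : E) : tangentKick (a • J) x = a • tangentKick J x := by
  simp only [tangentKick, real_inner_smul_left, smul_sub, smul_smul, mul_comm a]

/-- The Euler step along a nonnegative multiple of the tangential part is the geodesic kick with
the rescaled step: `eulerStep ε (a • p) x = geodesicKick (ε a) J x` for `p = tangentKick J x`,
`0 ≤ a`. -/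
theorem eulerStep_smul_tangentKick {a : ℝ} (ha : 0 ≤ a) (ε : ℝ) (J x : E) :
    eulerStep ε (a • tangentKick J x) x = geodesicKick (ε * a) J x := by
  unfold eulerStep geodesicKick
  rw [norm_smul, Real.norm_of_nonneg ha, smul_smul,
    show ε * (a * ‖tangentKick J x‖) = ε * a * ‖tangentKick J x‖ by ring]
  rcases eq_or_lt_of_le ha with h | h
  · subst h; simp
  · congr 1
    rw [div_mul_eq_mul_div, mul_comm a ‖tangentKick J x‖, mul_div_mul_right _ _ (ne_of_gt h)]

end Euler

/-! ## §3 E–S's site operators: the force (13), the eigenfunction property, eq. (15), eq. (16), eq. (17) -/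

section SiteOperators

variable [FiniteDimensional ℝ E] [DecidableEq Λ]

/-- **E–S's natural derivative at site `n`** (eq. (12), sitewise): the gradient at `y = x_n` of
`y ↦ G(x with x_n ← y/‖y‖)` — the tangential projection of the ordinary site gradient
(`SphereTangentialLaplacian.fderiv_comp_normalize`). -/
def siteGrad (n : Λ) (G : (Λ → E) → ℝ) (x : Λ → E) : E :=
  ∇ (fun y : E => G (Function.update x n (normalize y))) (x n)

/-- **E–S's second-order site operator `∂̃ⁱ_n∂̃ⁱ_n`**: the Laplacian at `y = x_n` of
`y ↦ G(x with x_n ← y/‖y‖)` (the Laplace–Beltrami operator of the `n`-th site sphere,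
`SphereTangentialLaplacian.laplacian_comp_normalize_eq_sphLaplacian`). -/
def siteLaplacian (n : Λ) (G : (Λ → E) → ℝ) (x : Λ → E) : ℝ :=
  Δ (fun y : E => G (Function.update x n (normalize y))) (x n)

/-- **The leading-order generator** `T_n = −∂̃_n S̃⁽⁰⁾` (E–S eqs. (14), (16): the gradient
ansatz for the flow, at leading order). -/
def loGenerator (κ S₀ : ℝ) (U : Λ → Λ → (E →L[ℝ] E)) (n : Λ) (x : Λ → E) : E :=
  -siteGrad n (loFlowAction κ S₀ U) x

variable {U : Λ → Λ → (E →L[ℝ] E)}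

omit [DecidableEq Λ] in
/-- The natural derivative of an affine function `y ↦ ⟪w, y⟫ + c` at a unit vector `u` is the
tangential part of `w`: `∇(y ↦ ⟪w, y/‖y‖⟫ + c)(u) = w − ⟪w, u⟫ u`. -/
theorem hasGradientAt_inner_comp_normalize {u : E} (hu : ‖u‖ = 1) (w : E) (c : ℝ) :
    HasGradientAt (fun y : E => ⟪w, normalize y⟫ + c) (tangentKick w u) u := by
  have hu0 : u ≠ 0 := by rintro rfl; simp at hu
  have hνu : normalize u = u := normalize_eq_self_of_norm_eq_one hu
  have hf : DifferentiableAt ℝ (fun z : E => ⟪w, z⟫ + c) u :=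
    (hasFDerivAt_inner_add_const w c u).differentiableAt
  have hg : DifferentiableAt ℝ (fun y : E => ⟪w, normalize y⟫ + c) u := by
    have hf' : DifferentiableAt ℝ (fun z : E => ⟪w, z⟫ + c) (normalize u) := by rwa [hνu]
    exact hf'.comp u (differentiableAt_normalize hu0)
  have hD : fderiv ℝ (fun y : E => ⟪w, normalize y⟫ + c) u =
      InnerProductSpace.toDual ℝ E (tangentKick w u) := by
    ext h
    have hcn := fderiv_comp_normalize (f := fun z : E => ⟪w, z⟫ + c) hu hf h
    rw [InnerProductSpace.toDual_apply_apply, hcn, (hasFDerivAt_inner_add_const w c u).fderiv,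
      innerSL_apply_apply]
    simp only [tangentKick, inner_sub_left, inner_sub_right, real_inner_smul_left,
      real_inner_smul_right, real_inner_comm u]
    ring
  rw [hasGradientAt_iff_hasFDerivAt, ← hD]
  exact hg.hasFDerivAt

/-- **E–S eq. (13), the force.**  On the product of unit spheres, `∂̃_n S = −2κ p_n` with
`p_n = (1 − x_n x_nᵀ) J_n = tangentKick (J_n x) (x n)`; the HMC force is `F_n = −∂̃_n S = 2κ p_n`
(`κ = Nβ`: `F_n = 2Nβ p_n`). -/
theorem siteGrad_esAction (hU0 : ∀ n, U n n = 0)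
    (hUadj : ∀ m n (v w : E), ⟪U m n v, w⟫ = ⟪v, U n m w⟫) (κ S₀ : ℝ) {x : Λ → E} {n : Λ}
    (hx : ‖x n‖ = 1) :
    siteGrad n (esAction κ S₀ U) x = -(2 * κ) • tangentKick (localField U n x) (x n) := by
  unfold siteGrad
  have h := esAction_update_eq_inner hU0 hUadj κ S₀ x n
  have h' : (fun y : E => esAction κ S₀ U (Function.update x n (normalize y))) =
      fun y => ⟪(-(2 * κ)) • localField U n x, normalize y⟫ +
        esAction κ S₀ U (Function.update x n 0) := by
    funext y; exact congrFun h (normalize y)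
  rw [h', (hasGradientAt_inner_comp_normalize hx _ _).gradient, tangentKick_smul]

/-- **The action is a site-wise eigenfunction**: `∂̃_n·∂̃_n S = 2κ(d−1)⟪J_n x, x_n⟫` on the
product of unit spheres (`−∂̃_n·∂̃_n S = (d−1) x_n·∇_n S`, the Hessian in `x_n` being zero). -/
theorem siteLaplacian_esAction (hU0 : ∀ n, U n n = 0)
    (hUadj : ∀ m n (v w : E), ⟪U m n v, w⟫ = ⟪v, U n m w⟫) (κ S₀ : ℝ) {x : Λ → E} {n : Λ}
    (hx : ‖x n‖ = 1) :
    siteLaplacian n (esAction κ S₀ U) x =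
      2 * κ * ((Module.finrank ℝ E : ℝ) - 1) * ⟪localField U n x, x n⟫ := by
  unfold siteLaplacian
  have h := esAction_update_eq_inner hU0 hUadj κ S₀ x n
  have h' : (fun y : E => esAction κ S₀ U (Function.update x n (normalize y))) =
      fun y => ⟪(-(2 * κ)) • localField U n x, normalize y⟫ +
        esAction κ S₀ U (Function.update x n 0) := by
    funext y; exact congrFun h (normalize y)
  rw [h', laplacian_inner_comp_normalize hx, real_inner_smul_left]
  ring

/-- **`−Σ_n ∂̃_n·∂̃_n S = 2(d−1)(S − S₀)`**: up to its constant, the action is an eigenfunction of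
the lattice Laplace–Beltrami operator `−Σ_n ∂̃_n·∂̃_n` with eigenvalue `2(d−1)` (CP(N−1):
`2(2N−1)`). -/
theorem neg_sum_siteLaplacian_esAction (hU0 : ∀ n, U n n = 0)
    (hUadj : ∀ m n (v w : E), ⟪U m n v, w⟫ = ⟪v, U n m w⟫) (κ S₀ : ℝ) {x : Λ → E}
    (hx : ∀ n, ‖x n‖ = 1) :
    -∑ n, siteLaplacian n (esAction κ S₀ U) x =
      2 * ((Module.finrank ℝ E : ℝ) - 1) * (esAction κ S₀ U x - S₀) := by
  rw [esAction_sub_const]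
  simp_rw [siteLaplacian_esAction hU0 hUadj κ S₀ (hx _)]
  calc -∑ n, 2 * κ * ((Module.finrank ℝ E : ℝ) - 1) * ⟪localField U n x, x n⟫
      = ∑ n, 2 * ((Module.finrank ℝ E : ℝ) - 1) * (-κ * ⟪x n, localField U n x⟫) := by
        rw [← Finset.sum_neg_distrib]
        refine Finset.sum_congr rfl fun n _ => ?_
        rw [real_inner_comm (x n)]
        ring
    _ = 2 * ((Module.finrank ℝ E : ℝ) - 1) * (-κ * ∑ n, ⟪x n, localField U n x⟫) := by
        rw [Finset.mul_sum, Finset.mul_sum]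

/-- **E–S eq. (15): `S̃⁽⁰⁾ = S/(2(d−1))` solves Lüscher's leading-order equation**
`−Σ_n ∂̃_n·∂̃_n S̃⁽⁰⁾ = S + C` (with `C = −S₀`) on the product of unit spheres, for `d ≥ 2`
(E–S: "One result of [Lüscher 2010] is that the leading term of `S̃` fulfills
`−Σ_n ∂̃ⁱ_n∂̃ⁱ_n S̃⁽⁰⁾ = S + C` … This immediately leads to `S̃⁽⁰⁾ = S/(2(2N−1))`"). -/
theorem neg_sum_siteLaplacian_loFlowAction (hU0 : ∀ n, U n n = 0)
    (hUadj : ∀ m n (v w : E), ⟪U m n v, w⟫ = ⟪v, U n m w⟫) (hd : 2 ≤ Module.finrank ℝ E)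
    (κ S₀ : ℝ) {x : Λ → E} (hx : ∀ n, ‖x n‖ = 1) :
    -∑ n, siteLaplacian n (loFlowAction κ S₀ U) x = esAction κ S₀ U x - S₀ := by
  have hd' : (2 * ((Module.finrank ℝ E : ℝ) - 1)) ≠ 0 := by
    have : (2 : ℝ) ≤ Module.finrank ℝ E := by exact_mod_cast hd
    intro h; nlinarith
  rw [loFlowAction_eq, neg_sum_siteLaplacian_esAction hU0 hUadj _ _ hx, esAction_smul, ← mul_sub,
    ← mul_assoc, mul_inv_cancel₀ hd', one_mul]

/-- **E–S eq. (16): the leading-order generator is `T_n = (κ/(d−1)) p_n`**,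
`p_n = tangentKick (J_n x) (x n)` (`κ = Nβ`, `d = 2N`: `T_n = Nβ/(2N−1) · p_n`). -/
theorem loGenerator_eq (hU0 : ∀ n, U n n = 0)
    (hUadj : ∀ m n (v w : E), ⟪U m n v, w⟫ = ⟪v, U n m w⟫) (hd : 2 ≤ Module.finrank ℝ E)
    (κ S₀ : ℝ) {x : Λ → E} {n : Λ} (hx : ‖x n‖ = 1) :
    loGenerator κ S₀ U n x =
      (κ / ((Module.finrank ℝ E : ℝ) - 1)) • tangentKick (localField U n x) (x n) := by
  have hd' : ((Module.finrank ℝ E : ℝ) - 1) ≠ 0 := by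
    have : (2 : ℝ) ≤ Module.finrank ℝ E := by exact_mod_cast hd
    intro h; linarith
  rw [loGenerator, loFlowAction_eq, siteGrad_esAction hU0 hUadj _ _ hx, ← neg_smul, neg_neg]
  congr 1
  field_simp

/-- **The generator is the HMC force divided by `2(d−1)`**: `T_n = F_n/(2(d−1))`,
`F_n = −∂̃_n S` (E–S: `T⁽⁰⁾_n ∝ p_n ∝ F_n`). -/
theorem loGenerator_eq_force (hU0 : ∀ n, U n n = 0)
    (hUadj : ∀ m n (v w : E), ⟪U m n v, w⟫ = ⟪v, U n m w⟫) (hd : 2 ≤ Module.finrank ℝ E)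
    (κ S₀ : ℝ) {x : Λ → E} {n : Λ} (hx : ‖x n‖ = 1) :
    loGenerator κ S₀ U n x =
      (2 * ((Module.finrank ℝ E : ℝ) - 1))⁻¹ • (-siteGrad n (esAction κ S₀ U) x) := by
  have hd' : ((Module.finrank ℝ E : ℝ) - 1) ≠ 0 := by
    have : (2 : ℝ) ≤ Module.finrank ℝ E := by exact_mod_cast hd
    intro h; linarith
  rw [loGenerator_eq hU0 hUadj hd κ S₀ hx, siteGrad_esAction hU0 hUadj κ S₀ hx, ← neg_smul,
    neg_neg, smul_smul]
  congr 1
  field_simp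

/-- **E–S eq. (17) = the rung's site map.**  On the product of unit spheres, for `0 ≤ κ` and
`d ≥ 2`, the Euler step with step `ε` of the leading-order flow `ẋ_n = T_n(x)` at site `n` is
`geodesicKick (ε κ/(d−1)) (J_n x) (x n)` — the single-site update whose exact Jacobian (E–S eq.
(18)), bijectivity range, checkerboard sweep and THMC exactness are the tree's
`SphereKickJacobian*` / `SphereKickTHMC` / `SphereKickSweep*` / `SphereSweepTHMC*` files.  With
`κ = Nβ`, `d = 2N` the step constant is `ε_s Nβ/(2N−1)`, the one in the printed angle map and
Jacobian. -/
theorem eulerStep_loGenerator (hU0 : ∀ n, U n n = 0)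
    (hUadj : ∀ m n (v w : E), ⟪U m n v, w⟫ = ⟪v, U n m w⟫) (hd : 2 ≤ Module.finrank ℝ E)
    {κ : ℝ} (hκ : 0 ≤ κ) (S₀ ε : ℝ) {x : Λ → E} {n : Λ} (hx : ‖x n‖ = 1) :
    eulerStep ε (loGenerator κ S₀ U n x) (x n) =
      geodesicKick (ε * (κ / ((Module.finrank ℝ E : ℝ) - 1))) (localField U n x) (x n) := by
  have ha : 0 ≤ κ / ((Module.finrank ℝ E : ℝ) - 1) := by
    have : (2 : ℝ) ≤ Module.finrank ℝ E := by exact_mod_cast hd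
    exact div_nonneg hκ (by linarith)
  rw [loGenerator_eq hU0 hUadj hd κ S₀ hx, eulerStep_smul_tangentKick ha]

end SiteOperators

end Summit.Ventures.LatticeQCDFlow.Exactness

end
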